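import Summits.AtomisticToContinuum.HydrodynamicLimit.Theorems.AnnealedZeroHorizonMeanFluxClosureCollisionalVirialClosure
import HarnessLib

/-!
# Stub VIRIAL `stub_collisionalVirialClosure` of crux `MeanFluxClosure`
# (stmt-AtomisticToContinuum-9256, route AnnealedZeroHorizon, line `registered`): EOS-free part B —
# in EQUILIBRIUM the collisional stress of `Dφ` has mean exactly zero (translation averaging)

Continuation of `…CollisionalVirialClosure` (pathwise covariance; invariance of the mean of a shifted stress at
constant profiles). Here the averaging is carried out:

* `integral_integral_avg_collisionalStress_translate` — ONE Fubini over `𝕋³ × Config` (all continuous positive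
  profiles, `0 < σ < 1/2`): `∫_y E[c · collisionalStress (A (· + y)) ∘ Φ_{t₁}] dy = E[c · collisionalStress (∫A) ∘ Φ_{t₁}]`;
  the integrand `(y, z) ↦ 𝟙_good(z) c · collisionalStress (A (· + y)) (Φ_{t₁} z)` is a Carathéodory function
  (continuous in `y` — a finite collision sum —, measurable in `z` — `measurable_indicator_collisionalStress_torus`),
  dominated by `c sup‖A‖ σ_N ½ RS ∘ Φ_{t₁}`, integrable by FLUX (`integrable_relSpeedFunctional_flow`);
* `integral_avg_collisionalStress_flow_eq_const` — at CONSTANT profiles the left side is `E[c · collisionalStress A ∘ Φ_{t₁}]`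
  itself (part A), hence **the equilibrium mean of the collisional stress of a continuous field `A` is that of the
  constant field `∫_{𝕋³} A`**; `…_eq_zero_const` — it vanishes when `∫ A = 0`;
* `integral_fderiv_eq_zero` (`∫_{𝕋³} Dφ = 0` as a continuous linear map), `integral_fderiv_sub_smul_id_eq_zero`,
  `integral_divergence_smul_id_eq_zero` — the three fields of the virial split have vanishing space average;
* `stub_collisionalVirialEquilibriumStress` — registered sub-goal of stmt-AtomisticToContinuum-9256: in equilibrium,
  for every `N`, the stub's `c · collisionalStress (Dφ) ∘ Φ_{t₁}`, its deviatoric part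
  `c · collisionalStress (Dφ − (div φ/3) 𝟙) ∘ Φ_{t₁}` and its pressure part `c · collisionalVirial (div φ/3) ∘ Φ_{t₁}` are
  integrable with mean EXACTLY `0`; `stub_collisionalVirialStressConst` — the same in the crux's format
  (`∀ᶠ N, ∀ D, D = … → Integrable D ∧ |∫ D| ≤ ε`) for the collisional-stress summand ALONE of stub VIRIAL.

So at constant profiles stub VIRIAL is EQUIVALENT to the mean closure of `J_φ − I_φ` alone (ideal minus full Euler
stress of the mollified fields: the equation-of-state obstruction, untouched here).
References: H. Spohn, *Large Scale Dynamics of Interacting Particles* (1991), Part I §2.3, §3.2 (3.15).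
-/

noncomputable section

namespace Summit.AtomisticToContinuum.HydrodynamicLimit.Theorems

open scoped BigOperators ENNReal Topology InnerProductSpace
open MeasureTheory Set Filter Function
open Literature.MathematicalPhysics.KineticTheory Literature.Analysis.FluidPDE Literature.Analysis.FunctionSpaces

namespace CollisionalVirialClosure

section Fubini

variable {σ : ℝ} {N : ℕ} (Φ : HardSphereFlow (Torus.geometry (Fin 3)) (hsDiameter σ N) (N + 1))

open CollisionalStressClosure CollisionEnergyExchangeMeanBound in
/-- **Translation averaging under the local Gibbs law (one Fubini).** For continuous positive profiles,
`0 < σ < 1/2`, a continuous matrix field `A` and `0 ≤ t₁ ≤ t₂`: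
`∫_y E[c · collisionalStress (A (· + y)) ∘ Φ_{t₁}] dy = E[c · collisionalStress (∫ A) ∘ Φ_{t₁}]`. The integrand
`(y, z) ↦ 𝟙_good(z) c · collisionalStress (A (· + y)) (Φ_{t₁} z)` is a Carathéodory function (continuous in `y`,
measurable in `z`), dominated by `c sup‖A‖ σ_N ½ RS ∘ Φ_{t₁} ∈ L¹` (FLUX). [folklore] -/
theorem integral_integral_avg_collisionalStress_translate {a₀ θ₀ : T3 → ℝ} {u₀ : T3 → V3}
    (ha : Continuous a₀) (hθ : Continuous θ₀) (hu : Continuous u₀) (ha0 : ∀ x, 0 < a₀ x)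
    (hθ0 : ∀ x, 0 < θ₀ x) (hσ : 0 < σ) (hσ₂ : σ < 2⁻¹) {A : T3 → V3 →L[ℝ] V3} (hA : Continuous A)
    {t₁ t₂ : ℝ} (h₁ : 0 ≤ t₁) (h₁₂ : t₁ ≤ t₂) :
    ∫ y, (∫ z, ((N + 1 : ℕ) : ℝ)⁻¹ * Φ.collisionalStress (fun x => A (x + y)) (Φ.flow t₁ z) (t₂ - t₁)
        ∂localGibbsLaw σ a₀ u₀ θ₀ N Φ) =
      ∫ z, ((N + 1 : ℕ) : ℝ)⁻¹ * Φ.collisionalStress (fun _ => ∫ y, A y) (Φ.flow t₁ z) (t₂ - t₁)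
        ∂localGibbsLaw σ a₀ u₀ θ₀ N Φ := by
  set μ := localGibbsLaw σ a₀ u₀ θ₀ N Φ with hμ
  haveI : IsProbabilityMeasure μ :=
    isProbabilityMeasure_localGibbsLaw ha hθ hu ha0 hθ0 (hσ₂.le.trans (by norm_num)) N Φ
  set c : ℝ := ((N + 1 : ℕ) : ℝ)⁻¹ with hc
  have hc0 : 0 ≤ c := inv_nonneg.2 (Nat.cast_nonneg _)
  have hε : hsDiameter σ N < 2⁻¹ := (hsDiameter_le hσ.le N).trans_lt hσ₂
  have hε₀ : 0 ≤ hsDiameter σ N := (hsDiameter_pos hσ N).le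
  obtain ⟨C, hC⟩ := isCompact_univ.exists_bound_of_continuousOn hA.continuousOn
  have hC' : ∀ (y x : T3), ‖A (x + y)‖ ≤ C := fun y x => hC _ (mem_univ _)
  have hC0 : 0 ≤ C := (norm_nonneg _).trans (hC 0 (mem_univ _))
  -- the Carathéodory integrand
  set U : T3 → Config (N + 1) (Fin 3) T3 → ℝ := fun y =>
    Φ.good.indicator fun z => c * Φ.collisionalStress (fun x => A (x + y)) (Φ.flow t₁ z) (t₂ - t₁) with hU
  have hUm : ∀ y, Measurable (U y) := by
    intro y
    have hAy : Continuous fun x => A (x + y) := hA.comp (continuous_id.add continuous_const)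
    have hW := Φ.measurable_indicator_collisionalStress_torus hε hAy (t₂ - t₁)
    have hEq : U y = Φ.good.indicator fun z => c * Φ.good.indicator
        (fun w => Φ.collisionalStress (fun x => A (x + y)) w (t₂ - t₁)) (Φ.flow t₁ z) := by
      refine Set.indicator_congr fun z hz => ?_
      rw [indicator_of_mem (Φ.mapsTo_good t₁ hz)]
    rw [hEq]
    exact ((hW.comp (Φ.measurable_flow t₁)).const_mul c).indicator Φ.measurableSet_good
  have hUc : ∀ z, Continuous fun y => U y z := by
    intro z
    by_cases hz : z ∈ Φ.good
    · simp only [hU, indicator_of_mem hz, HardSphereFlow.collisionalStress,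
        HardSphereFlow.collisionalTransferFunctional_eq]
      exact continuous_const.mul (continuous_collisionalTransferFunctional_param
        (Φ.isTrajectory _ (Φ.mapsTo_good t₁ hz))
        (g := fun y => stressKernel (Torus.geometry (Fin 3)) fun x => A (x + y))
        (fun i j pre post => continuous_stressKernel_translate hA i j pre post) 0 (t₂ - t₁))
    · simp only [hU, indicator_of_notMem hz]
      exact continuous_const
  have hUjm : Measurable (Function.uncurry U) := measurable_uncurry_of_continuous_of_measurable hUc hUm
  -- domination by the relative-speed functional
  set RS : Config (N + 1) (Fin 3) T3 → ℝ := fun z => Φ.collisionalTransferFunctional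
    (fun (i j : Fin (N + 1)) (pre _post : Config (N + 1) (Fin 3) T3) => ‖(pre i).2 - (pre j).2‖)
    (Φ.flow t₁ z) (t₂ - t₁) with hRS
  have hRSi : Integrable RS μ :=
    integrable_relSpeedFunctional_flow ha hθ hu ha0 hθ0 hσ (hσ₂.le.trans_eq (by norm_num)) Φ h₁ h₁₂
  have hbound : ∀ y z, ‖U y z‖ ≤ c * (C * (hsDiameter σ N * (2⁻¹ * RS z))) := by
    intro y z
    by_cases hz : z ∈ Φ.good
    · simp only [hU, indicator_of_mem hz, norm_mul, Real.norm_eq_abs, abs_of_nonneg hc0]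
      refine mul_le_mul_of_nonneg_left ?_ hc0
      obtain ⟨hb1, hb2⟩ := abs_collisionalStress_flow_le Φ hε₀ hε (hC' y) hz t₁ (t₂ - t₁)
      exact hb1.trans (mul_le_mul_of_nonneg_left hb2 hC0)
    · simp only [hU, indicator_of_notMem hz, norm_zero]
      exact mul_nonneg hc0 (mul_nonneg hC0 (mul_nonneg hε₀ (mul_nonneg (by norm_num)
        (collisionalTransferFunctional_nonneg Φ (fun _ _ _ _ => norm_nonneg _) _ _))))
  have hint : Integrable (Function.uncurry U) ((volume : Measure T3).prod μ) :=
    Integrable.mono' (((((hRSi.const_mul 2⁻¹).const_mul (hsDiameter σ N)).const_mul C).const_mul c).comp_snd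
      volume) hUjm.aestronglyMeasurable (ae_of_all _ fun p => hbound p.1 p.2)
  -- a.e. identification of `U y` with the integrand, and the `y`-average on the good set
  have hgood : ∀ᵐ z ∂μ, z ∈ Φ.good :=
    (localGibbsLaw_absolutelyContinuous σ a₀ u₀ θ₀ N Φ).ae_le Φ.ae_mem_good
  have h1 : ∀ y, ∫ z, c * Φ.collisionalStress (fun x => A (x + y)) (Φ.flow t₁ z) (t₂ - t₁) ∂μ =
      ∫ z, U y z ∂μ := fun y => integral_congr_ae (by
    filter_upwards [hgood] with z hz
    simp only [hU, indicator_of_mem hz])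
  have h2 : ∀ᵐ z ∂μ, ∫ y, U y z =
      c * Φ.collisionalStress (fun _ => ∫ y, A y) (Φ.flow t₁ z) (t₂ - t₁) := by
    filter_upwards [hgood] with z hz
    simp only [hU, indicator_of_mem hz, HardSphereFlow.collisionalStress_eq]
    rw [integral_const_mul]
    congr 1
    exact integral_collisionalStress_translate (Φ.isTrajectory _ (Φ.mapsTo_good t₁ hz)) hA 0 (t₂ - t₁)
  calc ∫ y, (∫ z, c * Φ.collisionalStress (fun x => A (x + y)) (Φ.flow t₁ z) (t₂ - t₁) ∂μ)
      = ∫ y, (∫ z, U y z ∂μ) := integral_congr_ae (ae_of_all _ h1)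
    _ = ∫ z, (∫ y, U y z) ∂μ := integral_integral_swap hint
    _ = _ := integral_congr_ae h2

end Fubini

/-! ## Equilibrium: the mean collisional stress is the mean collisional stress of the averaged field -/

section Equilibrium

variable {σ : ℝ} {N : ℕ} (Φ : HardSphereFlow (Torus.geometry (Fin 3)) (hsDiameter σ N) (N + 1))

/-- **Equilibrium mean of a collisional stress = that of the space-averaged (constant) field.** At constant
profiles `a, θ > 0`, `u`, for `0 < σ < 1/2`, every `N`, every flow, `0 ≤ t₁ ≤ t₂` and a continuous matrix field
`A`: `E[c · collisionalStress A ∘ Φ_{t₁}] = E[c · collisionalStress (∫_{𝕋³} A) ∘ Φ_{t₁}]` (`y ↦ E[c S_{A(·+y)}]` is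
constant `= E[c S_A]`; integrate in `y` and use the Fubini identity). [folklore] -/
theorem integral_avg_collisionalStress_flow_eq_const (hσ : 0 < σ) (hσ₂ : σ < 2⁻¹) {a θ : ℝ} (ha : 0 < a)
    (hθ : 0 < θ) (u : V3) {A : T3 → V3 →L[ℝ] V3} (hA : Continuous A) {t₁ t₂ : ℝ} (h₁ : 0 ≤ t₁)
    (h₁₂ : t₁ ≤ t₂) :
    ∫ z, ((N + 1 : ℕ) : ℝ)⁻¹ * Φ.collisionalStress A (Φ.flow t₁ z) (t₂ - t₁)
        ∂localGibbsLaw σ (fun _ => a) (fun _ => u) (fun _ => θ) N Φ =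
      ∫ z, ((N + 1 : ℕ) : ℝ)⁻¹ * Φ.collisionalStress (fun _ => ∫ y, A y) (Φ.flow t₁ z) (t₂ - t₁)
        ∂localGibbsLaw σ (fun _ => a) (fun _ => u) (fun _ => θ) N Φ := by
  rw [← integral_integral_avg_collisionalStress_translate Φ continuous_const continuous_const
    continuous_const (fun _ => ha) (fun _ => hθ) hσ hσ₂ hA h₁ h₁₂]
  symm
  calc ∫ y, (∫ z, ((N + 1 : ℕ) : ℝ)⁻¹ * Φ.collisionalStress (fun x => A (x + y)) (Φ.flow t₁ z) (t₂ - t₁)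
        ∂localGibbsLaw σ (fun _ => a) (fun _ => u) (fun _ => θ) N Φ)
      = ∫ _y : T3, (∫ z, ((N + 1 : ℕ) : ℝ)⁻¹ * Φ.collisionalStress A (Φ.flow t₁ z) (t₂ - t₁)
        ∂localGibbsLaw σ (fun _ => a) (fun _ => u) (fun _ => θ) N Φ) :=
        integral_congr_ae (ae_of_all _ fun y =>
          integral_collisionalStress_translate_const Φ a θ u A y h₁ _ _)
    _ = _ := by rw [integral_const, probReal_univ, one_smul]

/-- **Fields with vanishing space average have mean-zero equilibrium collisional stress**: same hypotheses,
`∫_{𝕋³} A = 0` implies `E[c · collisionalStress A ∘ Φ_{t₁}] = 0`. [folklore] -/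
theorem integral_avg_collisionalStress_flow_eq_zero_const (hσ : 0 < σ) (hσ₂ : σ < 2⁻¹) {a θ : ℝ}
    (ha : 0 < a) (hθ : 0 < θ) (u : V3) {A : T3 → V3 →L[ℝ] V3} (hA : Continuous A) (hA0 : ∫ y, A y = 0)
    {t₁ t₂ : ℝ} (h₁ : 0 ≤ t₁) (h₁₂ : t₁ ≤ t₂) :
    ∫ z, ((N + 1 : ℕ) : ℝ)⁻¹ * Φ.collisionalStress A (Φ.flow t₁ z) (t₂ - t₁)
        ∂localGibbsLaw σ (fun _ => a) (fun _ => u) (fun _ => θ) N Φ = 0 := by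
  rw [integral_avg_collisionalStress_flow_eq_const Φ hσ hσ₂ ha hθ u hA h₁ h₁₂, hA0]
  simp only [HardSphereFlow.collisionalStress_eq, collisionalStress_zero, mul_zero, integral_zero]

/-- **`∫_{𝕋³} Dφ = 0`** as a continuous linear map, for a smooth vector field `φ` (apply to `v`: the integral of
the directional derivative `∂_v φ` over the torus vanishes). [folklore] -/
theorem integral_fderiv_eq_zero {φ : T3 → V3} (hφ : Torus.IsSmooth φ) :
    ∫ y, Torus.fderiv φ y = 0 := by
  have h1 : Torus.IsContDiff 1 φ := (CollisionalStressClosure.exists_bounds_of_isSmooth hφ).1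
  have hint : Integrable (Torus.fderiv φ) := (Torus.continuous_fderiv h1).integrable_unitAddTorus
  refine ContinuousLinearMap.ext fun v => ?_
  rw [ContinuousLinearMap.integral_apply hint v]
  simp_rw [← Torus.lineDeriv_eq_fderiv_apply h1, Torus.integral_lineDeriv_eq_zero hφ v]
  simp

/-- The scalar field `(div φ / 3) 𝟙` has vanishing space average. [folklore] -/
theorem integral_divergence_smul_id_eq_zero {φ : T3 → V3} (hφ : Torus.IsSmooth φ) :
    ∫ y, (Torus.divergence φ y / 3) • ContinuousLinearMap.id ℝ V3 = 0 := by
  rw [integral_smul_const, integral_div, Torus.integral_divergence_eq_zero_holds hφ, zero_div,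
    zero_smul ℝ (ContinuousLinearMap.id ℝ V3)]

/-- The traceless part `Dφ − (div φ / 3) 𝟙` of the gradient of a smooth field has vanishing space average. [folklore] -/
theorem integral_fderiv_sub_smul_id_eq_zero {φ : T3 → V3} (hφ : Torus.IsSmooth φ) :
    ∫ y, (Torus.fderiv φ y - (Torus.divergence φ y / 3) • ContinuousLinearMap.id ℝ V3) = 0 := by
  have h1 : Torus.IsContDiff 1 φ := (CollisionalStressClosure.exists_bounds_of_isSmooth hφ).1
  have hint : Integrable (Torus.fderiv φ) := (Torus.continuous_fderiv h1).integrable_unitAddTorus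
  have hP : Continuous fun y => (Torus.divergence φ y / 3) • ContinuousLinearMap.id ℝ V3 :=
    (hφ.divergence.continuous.div_const 3).smul continuous_const
  rw [integral_sub hint hP.integrable_unitAddTorus, integral_fderiv_eq_zero hφ,
    integral_divergence_smul_id_eq_zero hφ, sub_zero]

/-- The collisional virial along the flow is the collisional stress of the scalar matrix field. [folklore] -/
theorem collisionalVirial_flow_eq_collisionalStress (ψ : T3 → ℝ) (w : Config (N + 1) (Fin 3) T3) (h : ℝ) :
    Φ.collisionalVirial ψ w h = Φ.collisionalStress (fun x => ψ x • ContinuousLinearMap.id ℝ V3) w h := by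
  simp only [HardSphereFlow.collisionalVirial, HardSphereFlow.collisionalStress, virialKernel_eq_stressKernel]

end Equilibrium

end CollisionalVirialClosure

open CollisionalVirialClosure CollisionalStressClosure in
/-- **Registered sub-goal `stub_collisionalVirialEquilibriumStress` of stmt-AtomisticToContinuum-9256 (stub VIRIAL at
CONSTANT profiles, EOS-free part; unconditional).** In equilibrium (`a, θ > 0`, `u`; `0 < σ < 1/2`; every `N`, every
flow `Φ` of `N + 1` spheres of diameter `hsDiameter σ N`, all `0 ≤ t₁ ≤ t₂`, every smooth `φ`), under
`G_N = localGibbsLaw σ a u θ N Φ` and with `c = (N+1)⁻¹`: (i) the stub's collisional stress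
`c · collisionalStress (Dφ) ∘ Φ_{t₁}` over `(0, t₂ − t₁]` is integrable with mean EXACTLY `0`; (ii) so is its
deviatoric part `c · collisionalStress (Dφ − (div φ/3) 𝟙) ∘ Φ_{t₁}`; (iii) so is its pressure part, the collisional
virial `c · collisionalVirial (div φ / 3) ∘ Φ_{t₁}` — translation averaging: the equilibrium mean of the collisional
stress of a continuous field `A` is that of the constant field `∫_{𝕋³} A`, and `∫ Dφ = 0`, `∫ div φ = 0`. [folklore] -/
theorem stub_collisionalVirialEquilibriumStress : ∀ (a θ : ℝ) (u : Literature.MathematicalPhysics.KineticTheory.V3), 0 < a → 0 < θ → ∀ (σ : ℝ), 0 < σ → σ < 1 / 2 → ∀ (N : ℕ) (Φ : Literature.Analysis.FluidPDE.HardSphereFlow (Literature.Analysis.FluidPDE.Torus.geometry (Fin 3)) (Literature.MathematicalPhysics.KineticTheory.hsDiameter σ N) (N + 1)) (t₁ t₂ : ℝ), 0 ≤ t₁ → t₁ ≤ t₂ → ∀ (φ : Literature.MathematicalPhysics.KineticTheory.T3 → Literature.MathematicalPhysics.KineticTheory.V3), Literature.Analysis.FunctionSpaces.Torus.IsSmooth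 φ → (MeasureTheory.Integrable (fun z => ((N + 1 : ℕ) : ℝ)⁻¹ * Φ.collisionalStress (Literature.Analysis.FunctionSpaces.Torus.fderiv φ) (Φ.flow t₁ z) (t₂ - t₁)) (Literature.MathematicalPhysics.KineticTheory.localGibbsLaw σ (fun _ => a) (fun _ => u) (fun _ => θ) N Φ) ∧ ∫ z, ((N + 1 : ℕ) : ℝ)⁻¹ * Φ.collisionalStress (Literature.Analysis.FunctionSpaces.Torus.fderiv φ) (Φ.flow t₁ z) (t₂ - t₁) ∂Literature.MathematicalPhysics.KineticTheory.localGibbsLaw σ (fun _ => a) (fun _ => u) (fun _ => θ) N Φ = 0) ∧ (MeasureTheory.Integrable (fun z => ((N + 1 : ℕ) : ℝ)⁻¹ * Φ.collisionalStress (fun x => Literature.Analysis.FunctionSpaces.Torus.fderiv φ x - (Literature.Analysis.FunctionSpaces.Torus.divergence φ x / 3) • ContinuousLinearMap.id ℝ Literature.MathematicalPhysics.KineticTheory.V3) (Φ.flow t₁ z) (t₂ - t₁)) (Literature.MathematicalPhysics.KineticTheory.localGibbsLaw σ (fun _ => a) (fun _ => u) (fun _ => θ) N Φ) ∧ ∫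 z, ((N + 1 : ℕ) : ℝ)⁻¹ * Φ.collisionalStress (fun x => Literature.Analysis.FunctionSpaces.Torus.fderiv φ x - (Literature.Analysis.FunctionSpaces.Torus.divergence φ x / 3) • ContinuousLinearMap.id ℝ Literature.MathematicalPhysics.KineticTheory.V3) (Φ.flow t₁ z) (t₂ - t₁) ∂Literature.MathematicalPhysics.KineticTheory.localGibbsLaw σ (fun _ => a) (fun _ => u) (fun _ => θ) N Φ = 0) ∧ (MeasureTheory.Integrable (fun z => ((N + 1 : ℕ) : ℝ)⁻¹ * Φ.collisionalVirial (fun x => Literature.Analysis.FunctionSpaces.Torus.divergence φ x / 3) (Φ.flow t₁ z) (t₂ - t₁)) (Literature.MathematicalPhysics.KineticTheory.localGibbsLaw σ (fun _ => a) (fun _ => u) (fun _ => θ) N Φ) ∧ ∫ z, ((N + 1 : ℕ) : ℝ)⁻¹ * Φ.collisionalVirial (fun x => Literature.Analysis.FunctionSpaces.Torus.divergence φ x / 3) (Φ.flow t₁ z) (t₂ - t₁) ∂Literature.MathematicalPhysics.KineticTheory.localGibbsLaw σ (fun _ => a) (fun _ => u) (fun _ => θ) N Φ = 0) := by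
  intro a θ u ha hθ σ hσ hσ₂ N Φ t₁ t₂ h₁ h₁₂ φ hφ
  have hσ₂' : σ < 2⁻¹ := by simpa only [one_div] using hσ₂
  obtain ⟨h1, -, -, -⟩ := exists_bounds_of_isSmooth hφ
  have hDc : Continuous (Torus.fderiv φ) := Torus.continuous_fderiv h1
  have hdivc : Continuous fun x => Torus.divergence φ x / 3 := hφ.divergence.continuous.div_const 3
  have hTc : Continuous fun x => Torus.fderiv φ x - (Torus.divergence φ x / 3) • ContinuousLinearMap.id ℝ V3 :=
    hDc.sub (hdivc.smul continuous_const)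
  have hPc : Continuous fun x => (Torus.divergence φ x / 3) • ContinuousLinearMap.id ℝ V3 :=
    hdivc.smul continuous_const
  have hint : ∀ {A : T3 → V3 →L[ℝ] V3}, Continuous A →
      Integrable (fun z => ((N + 1 : ℕ) : ℝ)⁻¹ * Φ.collisionalStress A (Φ.flow t₁ z) (t₂ - t₁))
        (localGibbsLaw σ (fun _ => a) (fun _ => u) (fun _ => θ) N Φ) := by
    intro A hA
    obtain ⟨C, hC⟩ := isCompact_univ.exists_bound_of_continuousOn hA.continuousOn
    exact (integrable_avg_collisionalStress_flow Φ continuous_const continuous_const continuous_const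
      (fun _ => ha) (fun _ => hθ) hσ hσ₂' hA (fun x => hC x (mem_univ _)) h₁ h₁₂).1
  have hV : ∀ w, Φ.collisionalVirial (fun x => Torus.divergence φ x / 3) w (t₂ - t₁) =
      Φ.collisionalStress (fun x => (Torus.divergence φ x / 3) • ContinuousLinearMap.id ℝ V3) w (t₂ - t₁) :=
    fun w => collisionalVirial_flow_eq_collisionalStress Φ _ w _
  refine ⟨⟨hint hDc, ?_⟩, ⟨hint hTc, ?_⟩, ?_⟩
  · exact integral_avg_collisionalStress_flow_eq_zero_const Φ hσ hσ₂' ha hθ u hDc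
      (integral_fderiv_eq_zero hφ) h₁ h₁₂
  · exact integral_avg_collisionalStress_flow_eq_zero_const Φ hσ hσ₂' ha hθ u hTc
      (integral_fderiv_sub_smul_id_eq_zero hφ) h₁ h₁₂
  · simp only [hV]
    exact ⟨hint hPc, integral_avg_collisionalStress_flow_eq_zero_const Φ hσ hσ₂' ha hθ u hPc
      (integral_divergence_smul_id_eq_zero hφ) h₁ h₁₂⟩


open CollisionalVirialClosure CollisionalStressClosure Filter in
/-- **Stub VIRIAL's collisional-stress summand alone, in the crux's format, at constant profiles**: for `a, θ > 0`,
`u`, `0 < σ < 1/2`, any flow family, `0 ≤ t₁ ≤ t₂`, `ε > 0` and smooth `φ`, eventually (indeed for every) `N`,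
`D = c · collisionalStress (Dφ) ∘ Φ_{t₁}` is integrable under `localGibbsLaw σ a u θ N (Φ N)` with `|∫ D| ≤ ε`
(`∫ D = 0`). Hence at constant profiles stub VIRIAL ⟺ the mean closure of `J_φ − I_φ`. [folklore] -/
theorem stub_collisionalVirialStressConst : ∀ (a θ : ℝ) (u : Literature.MathematicalPhysics.KineticTheory.V3), 0 < a → 0 < θ → ∀ (σ : ℝ), 0 < σ → σ < 1 / 2 → ∀ (Φ : (N : ℕ) → Literature.Analysis.FluidPDE.HardSphereFlow (Literature.Analysis.FluidPDE.Torus.geometry (Fin 3)) (Literature.MathematicalPhysics.KineticTheory.hsDiameter σ N) (N + 1)) (t₁ t₂ : ℝ), 0 ≤ t₁ → t₁ ≤ t₂ → ∀ (ε : ℝ), 0 < ε → ∀ (φ : Literature.MathematicalPhysics.KineticTheory.T3 → Literature.MathematicalPhysics.KineticTheory.V3), Literature.Analysis.FunctionSpaces.Torus.IsSmooth φ → ∀ᶠ N in Filter.atTop, ∀ D : Literature.Analysis.FluidPDE.Config (N + 1) (Fin 3) Literature.MathematicalPhysics.KineticTheory.T3 → ℝ, D = (fun z => ((N + 1 : ℕ)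 : ℝ)⁻¹ * (Φ N).collisionalStress (Literature.Analysis.FunctionSpaces.Torus.fderiv φ) ((Φ N).flow t₁ z) (t₂ - t₁)) → MeasureTheory.Integrable D (Literature.MathematicalPhysics.KineticTheory.localGibbsLaw σ (fun _ => a) (fun _ => u) (fun _ => θ) N (Φ N)) ∧ |∫ z, D z ∂Literature.MathematicalPhysics.KineticTheory.localGibbsLaw σ (fun _ => a) (fun _ => u) (fun _ => θ) N (Φ N)| ≤ ε := by
  intro a θ u ha hθ σ hσ hσ₂ Φ t₁ t₂ h₁ h₁₂ ε hε φ hφ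
  refine Eventually.of_forall fun N D hD => ?_
  obtain ⟨⟨hint, h0⟩, -, -⟩ := stub_collisionalVirialEquilibriumStress a θ u ha hθ σ hσ hσ₂ N (Φ N) t₁ t₂ h₁ h₁₂ φ hφ
  subst hD
  exact ⟨hint, by rw [h0, abs_zero]; exact hε.le⟩

end Summit.AtomisticToContinuum.HydrodynamicLimit.Theorems
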